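import Literature.Combinatorics.Optimization.PsdFactorizationSpaceExamples
import Literature.Combinatorics.Optimization.PsdMinimalPolytopes
import HarnessLib

/-!
# The regular hexagon: GRT 2013 Example 3.6 (ii) (a rank-four signed Hadamard square root of `S_H`)
# and FGPRT Example 7.5 (two distinct factorization orbits) — PROVED

Sources: J. Gouveia, R. Z. Robinson, R. R. Thomas, *Polytopes of minimum positive semidefinite rank*,
Discrete Comput. Geom. 50 (2013) 679–699 = arXiv:1205.5306 [GouveiaRobinsonThomas2013], Example 3.6
(held text `paper:arxiv-1205.5306`, chunk p08); H. Fawzi, J. Gouveia, P. A. Parrilo, R. Z. Robinson,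
R. R. Thomas, *Positive semidefinite rank*, Math. Program. 153 (2015) = arXiv:1407.4095 [FawziEtAl2015],
Example 7.5 (chunk p21). Vocabulary: `grtHexagonSlack` (`S_H`, `PsdMinimalPolytopes.lean`, where
Example 3.6 (iii)'s mixed factorization gives `hasPsdFactorization_grtHexagonSlack_four` and
`grtHexagonSlack_psdRank` gives `rank_psd S_H = 4`), `psdFactorizationSpace` (`𝒮ℱ(M)`) and the
`GL(k)`-orbit `conj_mem_psdFactorizationSpace` (`PsdFactorizationSpaceExamples.lean`).

* **GRT Example 3.6 (ii)** (p08, verbatim): "`√rank S_H < rank ⁺√S_H`. The all-nonnegative Hadamard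
  square root `⁺√S_H` has rank `5`. The following Hadamard square root has rank 4:
  `[[0,√2,2,2,√2,0],[0,0,√2,2,2,√2],[√2,0,0,√2,2,2],[−2,−√2,0,0,√2,2],[2,−2,−√2,0,0,√2],
  [√2,2,−2,−√2,0,0]]`. Thus, it is not enough to check the positive Hadamard square root of `S_P` to
  get `√rank S_P`." PROVED: `grtHexagonSqrt` is a Hadamard square root of `S_H` (`grtHexagonSqrt_sq`)
  of rank exactly `4` (`rank_grtHexagonSqrt`: the rank factorization `grtHexagonSqrt = U V` through
  `ℝ⁴` with `U` its first four columns, `grtHexagonSqrt_eq_mul`, and the `4 × 4` leading minor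
  `8√2 − 8 ≠ 0`), and the all-nonnegative square root `grtHexagonSqrtPos` has rank exactly `5`
  (alternating kernel vector and the leading `5 × 5` minor `32 − 16√2 ≠ 0`, `rank_grtHexagonSqrtPos`).
  Packaged as `GouveiaRobinsonThomas2013_ex36_ii`, with "`√rank S_H = 4`" in the tree's vocabulary
  `HasHadamardSqrtOfRankLE` (FGPRT Def. 5.2; `¬ (√rank ≤ 3)` because `rank_psd S_H = 4 ≤ √rank`,
  FGPRT Cor. 5.3 = `HasHadamardSqrtOfRankLE.hasPsdFactorization`).
* **The induced all-rank-one factorization** (GRT p08 (iii): "if … `rank_psd Q = n+1`, then … all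
  `S^{n+1}_+`-factorizations of `S_Q` have factors of rank one. However, even if `rank_psd Q = √rank Q`,
  but `rank_psd Q > n+1`, then there can be factorizations … in which the factors do not all have rank
  one as in the case of the hexagon"): the rows `a_i` of `U` and columns `b_j` of `V` give
  `(a_i a_iᵀ, b_j b_jᵀ) ∈ 𝒮ℱ(S_H)` of size `4` (`hexRankOne_mem`), while Example 3.6 (iii)'s printed
  factorization (`hexMixed_mem`, rows `vvᵀ`, columns `vvᵀ + wwᵀ`) has a column factor of rank `≥ 2`
  (`two_le_rank_hexMixedCol_one`).
* **FGPRT Example 7.5** (p21, verbatim): "Let `M` be the slack matrix of the regular hexagon … It was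
  shown in [GRT13] that `M` has rank three, psd rank four, and at least two distinct factorization
  orbits (since there exists a factorization consisting entirely of rank one matrices and another
  factorization using both rank one and rank two matrices)." PROVED as `FawziEtAl2015_ex75`:
  `rank S_H = 3` (`rank_grtHexagonSlack`), `rank_psd S_H = 4` (the tree's `grtHexagonSlack_psdRank`),
  and the two members of `𝒮ℱ(S_H)` above lie in different `GL(4)`-orbits in both directions (a
  congruence `L⁻¹ B Lᵀ⁻¹` of a rank-one matrix has rank `≤ 1`; for invertible `L` it preserves rank).
  The remaining sentences of Example 7.5 (the cones `P` and `Q` coincide, so Corollary 7.4's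
  conclusion fails) are not typed.

No new notions, no named facts; explicit matrices and vectors only.
-/

noncomputable section

open Matrix Finset
open scoped MatrixOrder

namespace Literature.Combinatorics.Optimization

/-! ### Small tools -/

/-- `Tr(a aᵀ · b bᵀ) = ⟨a, b⟩²`. [folklore] -/
private theorem trace_outer_mul_outer {n : ℕ} (a b : Fin n → ℝ) :
    (vecMulVec a a * vecMulVec b b).trace = (a ⬝ᵥ b) ^ 2 := by
  rw [vecMulVec_mul_vecMulVec, trace_vecMulVec, dotProduct_smul, smul_eq_mul, sq]

/-- `a aᵀ ⪰ 0` over `ℝ`. [folklore] -/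
private theorem posSemidef_outer {n : ℕ} (a : Fin n → ℝ) : (vecMulVec a a).PosSemidef := by
  simpa using Matrix.posSemidef_vecMulVec_self_star a

/-- `√2 · √2 = 2`. [folklore] -/
private theorem sqrt2_mul_self : Real.sqrt 2 * Real.sqrt 2 = 2 :=
  Real.mul_self_sqrt zero_le_two

/-! ### GRT Example 3.6 (ii): the signed square root of rank four -/

/-- GRT's signed Hadamard square root of `S_H` (p08 display). [cite: GouveiaRobinsonThomas2013, Ex. 3.6 (ii) (p08)] -/
def grtHexagonSqrt : Matrix (Fin 6) (Fin 6) ℝ :=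
  !![0, Real.sqrt 2, 2, 2, Real.sqrt 2, 0;
     0, 0, Real.sqrt 2, 2, 2, Real.sqrt 2;
     Real.sqrt 2, 0, 0, Real.sqrt 2, 2, 2;
     -2, -Real.sqrt 2, 0, 0, Real.sqrt 2, 2;
     2, -2, -Real.sqrt 2, 0, 0, Real.sqrt 2;
     Real.sqrt 2, 2, -2, -Real.sqrt 2, 0, 0]

/-- The all-nonnegative Hadamard square root `⁺√S_H`. [cite: GouveiaRobinsonThomas2013, Ex. 3.6 (ii) (p08)] -/
def grtHexagonSqrtPos : Matrix (Fin 6) (Fin 6) ℝ :=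
  !![0, Real.sqrt 2, 2, 2, Real.sqrt 2, 0;
     0, 0, Real.sqrt 2, 2, 2, Real.sqrt 2;
     Real.sqrt 2, 0, 0, Real.sqrt 2, 2, 2;
     2, Real.sqrt 2, 0, 0, Real.sqrt 2, 2;
     2, 2, Real.sqrt 2, 0, 0, Real.sqrt 2;
     Real.sqrt 2, 2, 2, Real.sqrt 2, 0, 0]

/-- Both displayed matrices are Hadamard square roots of `S_H`: entrywise squares give `S_H`.
[cite: GouveiaRobinsonThomas2013, Ex. 3.6 (ii) (p08)] -/
theorem grtHexagonSqrt_sq (i j : Fin 6) :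
    grtHexagonSqrt i j ^ 2 = grtHexagonSlack i j ∧ grtHexagonSqrtPos i j ^ 2 = grtHexagonSlack i j := by
  fin_cases i <;> fin_cases j <;> norm_num [grtHexagonSqrt, grtHexagonSqrtPos, grtHexagonSlack]

/-- The first four columns of `grtHexagonSqrt`. [cite: GouveiaRobinsonThomas2013, Ex. 3.6 (ii) (p08)] -/
def grtHexagonSqrtU : Matrix (Fin 6) (Fin 4) ℝ :=
  !![0, Real.sqrt 2, 2, 2;
     0, 0, Real.sqrt 2, 2;
     Real.sqrt 2, 0, 0, Real.sqrt 2;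
     -2, -Real.sqrt 2, 0, 0;
     2, -2, -Real.sqrt 2, 0;
     Real.sqrt 2, 2, -2, -Real.sqrt 2]

/-- The coefficients expressing all six columns of `grtHexagonSqrt` in its first four (reduced row
echelon form over `ℚ(√2)`). [cite: GouveiaRobinsonThomas2013, Ex. 3.6 (ii) (p08)] -/
def grtHexagonSqrtV : Matrix (Fin 4) (Fin 6) ℝ :=
  !![1, 0, 0, 0, -1, -1;
     0, 1, 0, 0, -1 + Real.sqrt 2, 0;
     0, 0, 1, 0, -2, -1 - Real.sqrt 2;
     0, 0, 0, 1, 1 + Real.sqrt 2, 1 + Real.sqrt 2]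

/-- The rank factorization `grtHexagonSqrt = U V` through `ℝ⁴`. [cite: GouveiaRobinsonThomas2013, Ex. 3.6 (ii) (p08)] -/
theorem grtHexagonSqrt_eq_mul : grtHexagonSqrt = grtHexagonSqrtU * grtHexagonSqrtV := by
  have hs := sqrt2_mul_self
  ext i j
  fin_cases i <;> fin_cases j <;>
    simp [grtHexagonSqrt, grtHexagonSqrtU, grtHexagonSqrtV, Matrix.mul_apply, Fin.sum_univ_four] <;>
    grind

/-- **GRT Example 3.6 (ii)**: "The following Hadamard square root has rank 4" — `≤ 4` by the
factorization through `ℝ⁴`, `≥ 4` by the leading `4 × 4` minor `8√2 − 8 ≠ 0`.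
[cite: GouveiaRobinsonThomas2013, Ex. 3.6 (ii) (p08)] -/
theorem rank_grtHexagonSqrt : grtHexagonSqrt.rank = 4 := by
  have hs := sqrt2_mul_self
  refine le_antisymm ?_ ?_
  · rw [grtHexagonSqrt_eq_mul]
    exact (Matrix.rank_mul_le_left _ _).trans
      ((Matrix.rank_le_card_width grtHexagonSqrtU).trans (by simp))
  · have hdet : (grtHexagonSqrt.submatrix (Fin.castLE (by norm_num : 4 ≤ 6))
        (Fin.castLE (by norm_num : 4 ≤ 6))).det ≠ 0 := by
      have h : (grtHexagonSqrt.submatrix (Fin.castLE (by norm_num : 4 ≤ 6))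
          (Fin.castLE (by norm_num : 4 ≤ 6))) =
          !![0, Real.sqrt 2, 2, 2; 0, 0, Real.sqrt 2, 2; Real.sqrt 2, 0, 0, Real.sqrt 2;
            -2, -Real.sqrt 2, 0, 0] := by
        ext i j
        fin_cases i <;> fin_cases j <;> rfl
      rw [h]
      have e1 : (Fin.succAbove (1 : Fin 4) (2 : Fin 3)) = 3 := by decide
      have e2 : (Fin.succAbove (2 : Fin 4) (2 : Fin 3)) = 3 := by decide
      have e3 : (Fin.succAbove (3 : Fin 4) (2 : Fin 3)) = 2 := by decide
      have hd : (!![0, Real.sqrt 2, 2, 2; 0, 0, Real.sqrt 2, 2; Real.sqrt 2, 0, 0, Real.sqrt 2;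
            -2, -Real.sqrt 2, 0, 0] : Matrix (Fin 4) (Fin 4) ℝ).det = 8 * Real.sqrt 2 - 8 := by
        simp [Matrix.det_succ_row_zero, Fin.sum_univ_succ, e1, e2, e3]
        grind
      rw [hd]
      nlinarith [Real.sqrt_nonneg 2, hs]
    simpa using Literature.LinearAlgebra.Matrix.card_le_rank_of_det_submatrix_ne_zero
      grtHexagonSqrt _ _ hdet

/-- The all-nonnegative square root is singular: the alternating vector `(−1,1,−1,1,−1,1)` is in
its kernel, so `rank ⁺√S_H ≤ 5`. [cite: GouveiaRobinsonThomas2013, Ex. 3.6 (ii) (p08)] -/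
theorem rank_grtHexagonSqrtPos_le : grtHexagonSqrtPos.rank ≤ 5 := by
  let K : Matrix (Fin 6) (Fin 1) ℝ := !![-1; 1; -1; 1; -1; 1]
  have hK : grtHexagonSqrtPos * K = 0 := by
    ext i j
    fin_cases i <;> fin_cases j <;>
      simp [grtHexagonSqrtPos, K, Matrix.mul_apply, Fin.sum_univ_succ]
  have hK1 : 1 ≤ K.rank := by
    have hdet : (K.submatrix (fun _ : Fin 1 => (1 : Fin 6)) (fun _ : Fin 1 => (0 : Fin 1))).det ≠ 0 := by
      simp [Matrix.det_unique, K]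
    simpa using Literature.LinearAlgebra.Matrix.card_le_rank_of_det_submatrix_ne_zero K _ _ hdet
  have h := Matrix.rank_add_rank_le_card_of_mul_eq_zero hK
  simp only [Fintype.card_fin] at h
  omega

/-- **GRT Example 3.6 (ii)**: "The all-nonnegative Hadamard square root `⁺√S_H` has rank `5`" — the
leading `5 × 5` minor is `32 − 16√2 ≠ 0`. [cite: GouveiaRobinsonThomas2013, Ex. 3.6 (ii) (p08)] -/
theorem rank_grtHexagonSqrtPos : grtHexagonSqrtPos.rank = 5 := by
  refine le_antisymm rank_grtHexagonSqrtPos_le ?_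
  have hs := sqrt2_mul_self
  have hdet : (grtHexagonSqrtPos.submatrix (Fin.castLE (by norm_num : 5 ≤ 6))
      (Fin.castLE (by norm_num : 5 ≤ 6))).det ≠ 0 := by
    have h : (grtHexagonSqrtPos.submatrix (Fin.castLE (by norm_num : 5 ≤ 6))
        (Fin.castLE (by norm_num : 5 ≤ 6))) =
        !![0, Real.sqrt 2, 2, 2, Real.sqrt 2; 0, 0, Real.sqrt 2, 2, 2; Real.sqrt 2, 0, 0, Real.sqrt 2, 2;
          2, Real.sqrt 2, 0, 0, Real.sqrt 2; 2, 2, Real.sqrt 2, 0, 0] := by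
      ext i j
      fin_cases i <;> fin_cases j <;> rfl
    rw [h]
    have e1 : (Fin.succAbove (1 : Fin 4) (2 : Fin 3)) = 3 := by decide
    have e2 : (Fin.succAbove (2 : Fin 4) (2 : Fin 3)) = 3 := by decide
    have e3 : (Fin.succAbove (3 : Fin 4) (2 : Fin 3)) = 2 := by decide
    have f1 : (Fin.succAbove (1 : Fin 5) (2 : Fin 4)) = 3 := by decide
    have f2 : (Fin.succAbove (1 : Fin 5) (3 : Fin 4)) = 4 := by decide
    have f3 : (Fin.succAbove (2 : Fin 5) (2 : Fin 4)) = 3 := by decide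
    have f4 : (Fin.succAbove (2 : Fin 5) (3 : Fin 4)) = 4 := by decide
    have f5 : (Fin.succAbove (3 : Fin 5) (2 : Fin 4)) = 2 := by decide
    have f6 : (Fin.succAbove (3 : Fin 5) (3 : Fin 4)) = 4 := by decide
    have f7 : (Fin.succAbove (4 : Fin 5) (2 : Fin 4)) = 2 := by decide
    have f8 : (Fin.succAbove (4 : Fin 5) (3 : Fin 4)) = 3 := by decide
    have hd : (!![0, Real.sqrt 2, 2, 2, Real.sqrt 2; 0, 0, Real.sqrt 2, 2, 2;
        Real.sqrt 2, 0, 0, Real.sqrt 2, 2; 2, Real.sqrt 2, 0, 0, Real.sqrt 2;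
        2, 2, Real.sqrt 2, 0, 0] : Matrix (Fin 5) (Fin 5) ℝ).det = 32 - 16 * Real.sqrt 2 := by
      simp [Matrix.det_succ_row_zero, Fin.sum_univ_succ, e1, e2, e3, f1, f2, f3, f4, f5, f6, f7, f8]
      grind
    rw [hd]
    nlinarith [Real.sqrt_nonneg 2, hs]
  simpa using Literature.LinearAlgebra.Matrix.card_le_rank_of_det_submatrix_ne_zero
    grtHexagonSqrtPos _ _ hdet

/-- **GRT Example 3.6 (ii)** packaged in the tree's vocabulary (`HasHadamardSqrtOfRankLE M r` =
"`√rank M ≤ r`", FGPRT Def. 5.2): "`√rank S_H < rank ⁺√S_H`" — `√rank S_H = 4` (the signed square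
root has rank `4`; no square root has rank `≤ 3` since `rank_psd S_H = 4 ≤ √rank`, Cor. 5.3) while
`rank ⁺√S_H = 5`. [cite: GouveiaRobinsonThomas2013, Ex. 3.6 (ii) (p08); FawziEtAl2015, Cor. 5.3 (p14)] -/
theorem GouveiaRobinsonThomas2013_ex36_ii :
    (HasHadamardSqrtOfRankLE grtHexagonSlack 4 ∧ ¬ HasHadamardSqrtOfRankLE grtHexagonSlack 3) ∧
    (∀ i j, grtHexagonSqrt i j ^ 2 = grtHexagonSlack i j) ∧ grtHexagonSqrt.rank = 4 ∧
    (∀ i j, grtHexagonSqrtPos i j ^ 2 = grtHexagonSlack i j) ∧ grtHexagonSqrtPos.rank = 5 := by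
  refine ⟨⟨⟨grtHexagonSqrt, fun i j => (grtHexagonSqrt_sq i j).1, rank_grtHexagonSqrt.le⟩,
    fun h3 => ?_⟩, fun i j => (grtHexagonSqrt_sq i j).1, rank_grtHexagonSqrt,
    fun i j => (grtHexagonSqrt_sq i j).2, rank_grtHexagonSqrtPos⟩
  have := grtHexagonSlack_psdRank.2 3 h3.hasPsdFactorization
  omega

/-! ### The two factorizations of `S_H` of size four -/

/-- Row vectors `a_i` (rows of `U`). [cite: GouveiaRobinsonThomas2013, Ex. 3.6 (ii) (p08)] -/
def hexRowVec (i : Fin 6) : Fin 4 → ℝ := fun l => grtHexagonSqrtU i l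

/-- Column vectors `b_j` (columns of `V`). [cite: GouveiaRobinsonThomas2013, Ex. 3.6 (ii) (p08)] -/
def hexColVec (j : Fin 6) : Fin 4 → ℝ := fun l => grtHexagonSqrtV l j

/-- `⟨a_i, b_j⟩ = (√S_H)_{ij}`. [cite: GouveiaRobinsonThomas2013, Ex. 3.6 (ii) (p08)] -/
theorem hexRowVec_dotProduct_hexColVec (i j : Fin 6) :
    hexRowVec i ⬝ᵥ hexColVec j = grtHexagonSqrt i j := by
  rw [grtHexagonSqrt_eq_mul, Matrix.mul_apply]
  rfl

/-- **The all-rank-one factorization of `S_H`** induced by the rank-four square root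
(`A_i = a_i a_iᵀ`, `B_j = b_j b_jᵀ`, `⟨A_i,B_j⟩ = ⟨a_i,b_j⟩² = S_H(i,j)`): a member of `𝒮ℱ(S_H)` at the
psd rank `4`. [cite: GouveiaRobinsonThomas2013, Ex. 3.6 (ii)–(iii) (p08); FawziEtAl2015, Ex. 7.5 (p21)] -/
theorem hexRankOne_mem :
    ((fun i => vecMulVec (hexRowVec i) (hexRowVec i)), fun j => vecMulVec (hexColVec j) (hexColVec j)) ∈
      psdFactorizationSpace grtHexagonSlack 4 := by
  refine ⟨fun i => posSemidef_outer _, fun j => posSemidef_outer _, fun i j => ?_⟩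
  change grtHexagonSlack i j = (vecMulVec (hexRowVec i) (hexRowVec i) *
    vecMulVec (hexColVec j) (hexColVec j)).trace
  rw [trace_outer_mul_outer, hexRowVec_dotProduct_hexColVec, (grtHexagonSqrt_sq i j).1]

/-- GRT Example 3.6 (iii)'s row vectors (`(1,1,0,0)⊗², …`). [cite: GouveiaRobinsonThomas2013, Ex. 3.6 (iii) (p08)] -/
def hexMixedRowVec : Fin 6 → Fin 4 → ℝ :=
  ![![1, 1, 0, 0], ![0, 1, 0, 1], ![0, 1, -1, 0], ![1, -1, 0, 0], ![0, 1, 0, -1], ![0, 1, 1, 0]]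

/-- GRT Example 3.6 (iii)'s first column vectors. [cite: GouveiaRobinsonThomas2013, Ex. 3.6 (iii) (p08)] -/
def hexMixedColVec₁ : Fin 6 → Fin 4 → ℝ :=
  ![![1, -1, 0, 1], ![1, 0, 0, 0], ![1, 1, 1, 0], ![1, 1, 0, 1], ![1, 0, 0, 0], ![1, -1, 1, 0]]

/-- GRT Example 3.6 (iii)'s second column vectors. [cite: GouveiaRobinsonThomas2013, Ex. 3.6 (iii) (p08)] -/
def hexMixedColVec₂ : Fin 6 → Fin 4 → ℝ :=
  ![![0, 0, 1, 0], ![0, 1, 1, -1], ![0, 0, 0, 1], ![0, 0, 1, 0], ![0, 1, -1, 1], ![0, 0, 0, 1]]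

/-- **GRT Example 3.6 (iii)'s factorization** ("six psd matrices of rank two to the columns … six
psd matrices of rank one to the rows") as a member of `𝒮ℱ(S_H)` at size `4`.
[cite: GouveiaRobinsonThomas2013, Ex. 3.6 (iii) (p08); FawziEtAl2015, Ex. 7.5 (p21)] -/
theorem hexMixed_mem :
    ((fun i => vecMulVec (hexMixedRowVec i) (hexMixedRowVec i)),
      fun j => vecMulVec (hexMixedColVec₁ j) (hexMixedColVec₁ j) +
        vecMulVec (hexMixedColVec₂ j) (hexMixedColVec₂ j)) ∈ psdFactorizationSpace grtHexagonSlack 4 := by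
  refine ⟨fun i => posSemidef_outer _, fun j => (posSemidef_outer _).add (posSemidef_outer _),
    fun i j => ?_⟩
  change grtHexagonSlack i j = (vecMulVec (hexMixedRowVec i) (hexMixedRowVec i) *
    (vecMulVec (hexMixedColVec₁ j) (hexMixedColVec₁ j) +
      vecMulVec (hexMixedColVec₂ j) (hexMixedColVec₂ j))).trace
  rw [Matrix.mul_add, Matrix.trace_add, trace_outer_mul_outer, trace_outer_mul_outer]
  fin_cases i <;> fin_cases j <;>
    simp [grtHexagonSlack, hexMixedRowVec, hexMixedColVec₁, hexMixedColVec₂, dotProduct,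
      Fin.sum_univ_four] <;> norm_num

/-- The column factor `B'_1 = e₀e₀ᵀ + (0,1,1,−1)(0,1,1,−1)ᵀ` of the mixed factorization has rank `≥ 2`
(its `{0,1} × {0,1}` minor is the identity). [cite: GouveiaRobinsonThomas2013, Ex. 3.6 (iii) (p08:
"rank two")] -/
theorem two_le_rank_hexMixedCol_one :
    2 ≤ (vecMulVec (hexMixedColVec₁ 1) (hexMixedColVec₁ 1) +
      vecMulVec (hexMixedColVec₂ 1) (hexMixedColVec₂ 1)).rank := by
  have hdet : ((vecMulVec (hexMixedColVec₁ 1) (hexMixedColVec₁ 1) +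
      vecMulVec (hexMixedColVec₂ 1) (hexMixedColVec₂ 1)).submatrix
      (Fin.castLE (by norm_num : 2 ≤ 4)) (Fin.castLE (by norm_num : 2 ≤ 4))).det ≠ 0 := by
    have h : ((vecMulVec (hexMixedColVec₁ 1) (hexMixedColVec₁ 1) +
        vecMulVec (hexMixedColVec₂ 1) (hexMixedColVec₂ 1)).submatrix
        (Fin.castLE (by norm_num : 2 ≤ 4)) (Fin.castLE (by norm_num : 2 ≤ 4))) = 1 := by
      ext i j
      fin_cases i <;> fin_cases j <;>
        simp [Matrix.submatrix, hexMixedColVec₁, hexMixedColVec₂]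
    rw [h, Matrix.det_one]
    exact one_ne_zero
  simpa using Literature.LinearAlgebra.Matrix.card_le_rank_of_det_submatrix_ne_zero _ _ _ hdet

/-! ### FGPRT Example 7.5 -/

/-- `rank S_H = 3` ("`M` has rank three"): `S_H = U₃ V₃` through `ℝ³` and the leading `3 × 3` minor
is `8`. [cite: FawziEtAl2015, Ex. 7.5 (p21)] -/
theorem rank_grtHexagonSlack : grtHexagonSlack.rank = 3 := by
  refine le_antisymm ?_ ?_
  · have h : grtHexagonSlack =
        (!![0, 2, 4; 0, 0, 2; 2, 0, 0; 4, 2, 0; 4, 4, 2; 2, 4, 4] : Matrix (Fin 6) (Fin 3) ℝ) *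
          (!![1, 0, 0, 1, 2, 2; 0, 1, 0, -2, -3, -2; 0, 0, 1, 2, 2, 1] : Matrix (Fin 3) (Fin 6) ℝ) := by
      ext i j
      fin_cases i <;> fin_cases j <;> simp [grtHexagonSlack, Matrix.mul_apply, Fin.sum_univ_three] <;>
        norm_num
    rw [h]
    exact (Matrix.rank_mul_le_left _ _).trans ((Matrix.rank_le_card_width _).trans (by simp))
  · have hdet : (grtHexagonSlack.submatrix (Fin.castLE (by norm_num : 3 ≤ 6))
        (Fin.castLE (by norm_num : 3 ≤ 6))).det ≠ 0 := by
      have h : grtHexagonSlack.submatrix (Fin.castLE (by norm_num : 3 ≤ 6))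
          (Fin.castLE (by norm_num : 3 ≤ 6)) = !![0, 2, 4; 0, 0, 2; 2, 0, 0] := by
        ext i j
        fin_cases i <;> fin_cases j <;> rfl
      rw [h]
      simp [Matrix.det_fin_three]
    simpa using Literature.LinearAlgebra.Matrix.card_le_rank_of_det_submatrix_ne_zero
      grtHexagonSlack _ _ hdet

/-- A congruence of a rank-one matrix has rank at most one: `P (b bᵀ) Q = (P b)(Qᵀ b)ᵀ`. [folklore] -/
private theorem rank_conj_outer_le_one {n : ℕ} (P Q : Matrix (Fin n) (Fin n) ℝ) (b : Fin n → ℝ) :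
    (P * vecMulVec b b * Q).rank ≤ 1 := by
  rw [Matrix.mul_vecMulVec, Matrix.vecMulVec_mul]
  exact Matrix.rank_vecMulVec_le _ _

/-- **FGPRT Example 7.5** (p21): the slack matrix `S_H` of the regular hexagon "has rank three, psd
rank four, and at least two distinct factorization orbits (since there exists a factorization
consisting entirely of rank one matrices and another factorization using both rank one and rank two
matrices)": the all-rank-one factorization `hexRankOne_mem` and GRT's mixed one `hexMixed_mem` are
members of `𝒮ℱ(S_H)` at the psd rank `4`, every factor of the first has rank `≤ 1`, a column factor
of the second has rank `≥ 2`, and no `L` conjugates the first into the second (any `L`) or the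
second into the first (`L ∈ GL(4)`). [cite: FawziEtAl2015, Ex. 7.5 (p21); GouveiaRobinsonThomas2013,
Ex. 3.6 (p08)] -/
theorem FawziEtAl2015_ex75 :
    grtHexagonSlack.rank = 3 ∧
    (HasPsdFactorization grtHexagonSlack 4 ∧ ∀ k, HasPsdFactorization grtHexagonSlack k → 4 ≤ k) ∧
    ((fun i => vecMulVec (hexRowVec i) (hexRowVec i)), fun j => vecMulVec (hexColVec j) (hexColVec j)) ∈
      psdFactorizationSpace grtHexagonSlack 4 ∧
    ((fun i => vecMulVec (hexMixedRowVec i) (hexMixedRowVec i)),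
      fun j => vecMulVec (hexMixedColVec₁ j) (hexMixedColVec₁ j) +
        vecMulVec (hexMixedColVec₂ j) (hexMixedColVec₂ j)) ∈ psdFactorizationSpace grtHexagonSlack 4 ∧
    (∀ i, (vecMulVec (hexRowVec i) (hexRowVec i)).rank ≤ 1 ∧
      (vecMulVec (hexColVec i) (hexColVec i)).rank ≤ 1) ∧
    2 ≤ (vecMulVec (hexMixedColVec₁ 1) (hexMixedColVec₁ 1) +
      vecMulVec (hexMixedColVec₂ 1) (hexMixedColVec₂ 1)).rank ∧
    (∀ L : Matrix (Fin 4) (Fin 4) ℝ,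
      (fun j => L⁻¹ * vecMulVec (hexColVec j) (hexColVec j) * L⁻¹ᵀ) ≠
        fun j => vecMulVec (hexMixedColVec₁ j) (hexMixedColVec₁ j) +
          vecMulVec (hexMixedColVec₂ j) (hexMixedColVec₂ j)) ∧
    (∀ L : Matrix (Fin 4) (Fin 4) ℝ, IsUnit L.det →
      (fun j => L⁻¹ * (vecMulVec (hexMixedColVec₁ j) (hexMixedColVec₁ j) +
          vecMulVec (hexMixedColVec₂ j) (hexMixedColVec₂ j)) * L⁻¹ᵀ) ≠
        fun j => vecMulVec (hexColVec j) (hexColVec j)) := by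
  refine ⟨rank_grtHexagonSlack, grtHexagonSlack_psdRank, hexRankOne_mem, hexMixed_mem,
    fun i => ⟨Matrix.rank_vecMulVec_le _ _, Matrix.rank_vecMulVec_le _ _⟩,
    two_le_rank_hexMixedCol_one, fun L hL => ?_, fun L hLu hL => ?_⟩
  · -- the image of the rank-one `B_1` would be the rank-two `B'_1`
    have h1 := congrFun hL 1
    have hle := rank_conj_outer_le_one L⁻¹ L⁻¹ᵀ (hexColVec 1)
    rw [h1] at hle
    have h2 := two_le_rank_hexMixedCol_one
    omega
  · -- a congruence by an invertible matrix preserves the rank `≥ 2` of `B'_1`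
    have h1 := congrFun hL 1
    have hinv : IsUnit L⁻¹.det := Matrix.isUnit_nonsing_inv_det L hLu
    have hinvT : IsUnit L⁻¹ᵀ.det := by rwa [Matrix.det_transpose]
    have hrk : (L⁻¹ * (vecMulVec (hexMixedColVec₁ 1) (hexMixedColVec₁ 1) +
        vecMulVec (hexMixedColVec₂ 1) (hexMixedColVec₂ 1)) * L⁻¹ᵀ).rank =
        (vecMulVec (hexMixedColVec₁ 1) (hexMixedColVec₁ 1) +
          vecMulVec (hexMixedColVec₂ 1) (hexMixedColVec₂ 1)).rank := by
      rw [Matrix.rank_mul_eq_left_of_isUnit_det _ _ hinvT, Matrix.rank_mul_eq_right_of_isUnit_det _ _ hinv]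
    have h2 := two_le_rank_hexMixedCol_one
    have h3 := Matrix.rank_vecMulVec_le (hexColVec 1) (hexColVec 1)
    rw [← h1, hrk] at h3
    omega

end Literature.Combinatorics.Optimization
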